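import Summits.AtomisticToContinuum.FouriersLaw.Theorems.PhononMeanFreePathDefs
import Summits.AtomisticToContinuum.FouriersLaw.Theorems.PhononMeanFreePathCoherentDephasingCoherentEnergyPointwise
import Summits.AtomisticToContinuum.FouriersLaw.Theorems.PhononMeanFreePathCoherentDephasingCoherentPositionPointwise
import Summits.AtomisticToContinuum.FouriersLaw.Theorems.PhononMeanFreePathCoherentDephasingTotalLocalLoss

/-!
# `CoherentDephasing` / line `Sketch`: the total coherent energy is bounded by the kick (stub `sum_cohEnergyDensity_le`)

Registered stub `sum_cohEnergyDensity_le` of line `Sketch` of crux `PhononMeanFreePath.CoherentDephasing`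
(stmt-AtomisticToContinuum-11810). For the `(N+1)`-site pinned anharmonic chain `pinnedChain ω₂ lam β γ` with both
Langevin baths at `T`, the coherent site energy density of `Theorems/PhononMeanFreePathDefs` is
`e_x(t) = ½(m_x(t)² + ω₂ n_x(t)²) + ¼ Σ_{b ∋ x} (n_{b+1}(t) - n_b(t))²` (`cohEnergyDensity`), with `m_x`, `n_x` the
momentum and position components of the coherent response field (`momResp`, `posResp`). CLAIM: for every `N` and
every `t > 0`,

  `Σ_{x=0}^{N} e_x(t) ≤ T² (1/2 + (ω₂/2 + 2) / min(ω₂, 1))`.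

PROOF (pure algebra on top of the two landed pointwise bounds). Write `M = Σ_x m_x² ≤ T²`
(`CoherentEnergyPointwise.sum_momResp_sq_le`) and `P = Σ_x n_x² ≤ T²/min(ω₂,1)`
(`CoherentPositionPointwise.sum_posResp_sq_le`). Summing the site densities, each bond `b` is seen by exactly its
two sites `b.castSucc`, `b.succ` (`sum_ite_or_eq`, from `TotalLocalLoss.sum_ite_val_castSucc_eq` /
`sum_ite_val_succ_eq`), so `Σ_x e_x = M/2 + (ω₂/2) P + ½ Σ_b (n_{b+1} - n_b)²`; and
`(n_{b+1} - n_b)² ≤ 2 n_{b+1}² + 2 n_b²` with `Σ_b n_{b+1}² ≤ P`, `Σ_b n_b² ≤ P` bounds the bond part by `2P`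
(`sum_siteEnergy_le`). Hence `Σ_x e_x ≤ T²/2 + (ω₂/2 + 2) T²/min(ω₂,1)`.
-/

noncomputable section

open MeasureTheory Set Filter Topology

namespace Summit.AtomisticToContinuum.FouriersLaw.Theorems.CoherentDephasing.CoherentEnergyTotal

open Literature.MathematicalPhysics.KineticTheory.HeatConduction (pinnedChain PhaseSpace)
open Summit.AtomisticToContinuum.FouriersLaw.Theorems.PhononMeanFreePath
open Summit.AtomisticToContinuum.FouriersLaw.Theorems.CoherentDephasing.TotalLocalLoss
  (sum_ite_val_succ_eq sum_ite_val_castSucc_eq)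

section Algebra

variable {N : ℕ}

/-- `Σ_x [b = x ∨ b + 1 = x] c = 2c`: bond `b` of the `(N+1)`-site chain has exactly the two (distinct) sites
`b.castSucc` and `b.succ` in `Fin (N+1)`. [folklore] -/
theorem sum_ite_or_eq (b : Fin N) (c : ℝ) :
    ∑ x : Fin (N + 1), (if (b : ℕ) = (x : ℕ) ∨ (b : ℕ) + 1 = (x : ℕ) then c else 0) = 2 * c := by
  have h : ∀ x : Fin (N + 1), (if (b : ℕ) = (x : ℕ) ∨ (b : ℕ) + 1 = (x : ℕ) then c else 0) =
      (if (b : ℕ) = (x : ℕ) then c else 0) + (if (b : ℕ) + 1 = (x : ℕ) then c else 0) := by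
    intro x
    by_cases h1 : (b : ℕ) = (x : ℕ)
    · have h2 : ¬((b : ℕ) + 1 = (x : ℕ)) := by omega
      rw [if_pos (Or.inl h1), if_pos h1, if_neg h2, add_zero]
    · by_cases h2 : (b : ℕ) + 1 = (x : ℕ)
      · rw [if_pos (Or.inr h2), if_neg h1, if_pos h2, zero_add]
      · rw [if_neg (not_or.mpr ⟨h1, h2⟩), if_neg h1, if_neg h2, add_zero]
  rw [Finset.sum_congr rfl fun x _ => h x, Finset.sum_add_distrib, sum_ite_val_castSucc_eq,
    sum_ite_val_succ_eq, two_mul]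

/-- **The site-energy bookkeeping bound (abstract form).** For fields `m n : Fin (N+1) → ℝ` with `Σ m² ≤ M`,
`Σ n² ≤ P` and `ω₂ ≥ 0`, the total of the site densities
`½(m_x² + ω₂ n_x²) + ¼ Σ_b [b = x ∨ b+1 = x] (n_{b+1} - n_b)²` is at most `M/2 + (ω₂/2 + 2) P`: each bond is counted
by exactly its two sites, and `(n_{b+1} - n_b)² ≤ 2 n_{b+1}² + 2 n_b²`. [folklore] -/
theorem sum_siteEnergy_le (m n : Fin (N + 1) → ℝ) {ω₂ M P : ℝ} (hω : 0 ≤ ω₂)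
    (hM : ∑ x, m x ^ 2 ≤ M) (hP : ∑ x, n x ^ 2 ≤ P) :
    ∑ x : Fin (N + 1), ((m x ^ 2 + ω₂ * n x ^ 2) / 2 +
      (1 / 4) * ∑ b : Fin N, if (b : ℕ) = (x : ℕ) ∨ (b : ℕ) + 1 = (x : ℕ) then
        (n b.succ - n b.castSucc) ^ 2 else 0) ≤ M / 2 + (ω₂ / 2 + 2) * P := by
  -- the bond part, counted exactly: each bond is seen by its two sites
  have hbond : ∑ x : Fin (N + 1), ∑ b : Fin N,
      (if (b : ℕ) = (x : ℕ) ∨ (b : ℕ) + 1 = (x : ℕ) then (n b.succ - n b.castSucc) ^ 2 else 0) =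
      2 * ∑ b : Fin N, (n b.succ - n b.castSucc) ^ 2 := by
    rw [Finset.sum_comm, Finset.mul_sum]
    exact Finset.sum_congr rfl fun b _ => sum_ite_or_eq b _
  -- the bond stretches are controlled by the positions
  have hd : ∑ b : Fin N, (n b.succ - n b.castSucc) ^ 2 ≤
      2 * ∑ b : Fin N, n b.succ ^ 2 + 2 * ∑ b : Fin N, n b.castSucc ^ 2 := by
    rw [Finset.mul_sum, Finset.mul_sum, ← Finset.sum_add_distrib]
    exact Finset.sum_le_sum fun b _ => by nlinarith [sq_nonneg (n b.succ + n b.castSucc)]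
  have hsucc : ∑ b : Fin N, n b.succ ^ 2 ≤ ∑ x : Fin (N + 1), n x ^ 2 := by
    rw [Fin.sum_univ_succ]
    linarith [sq_nonneg (n 0)]
  have hcast : ∑ b : Fin N, n b.castSucc ^ 2 ≤ ∑ x : Fin (N + 1), n x ^ 2 := by
    rw [Fin.sum_univ_castSucc]
    linarith [sq_nonneg (n (Fin.last N))]
  have hωP : ω₂ * ∑ x, n x ^ 2 ≤ ω₂ * P := mul_le_mul_of_nonneg_left hP hω
  rw [Finset.sum_add_distrib, ← Finset.mul_sum, hbond, ← Finset.sum_div, Finset.sum_add_distrib,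
    ← Finset.mul_sum]
  linarith

end Algebra

/-- **The total coherent energy never exceeds the kick (registered stub `sum_cohEnergyDensity_le`).** For the
pinned anharmonic chain with both baths at `T > 0`, every `N` and every `t > 0`:
`Σ_{x=0}^{N} e_x(t) ≤ T² (1/2 + (ω₂/2 + 2)/min(ω₂, 1))`, from `Σ_x m_x(t)² ≤ T²`
(`CoherentEnergyPointwise.sum_momResp_sq_le`), `Σ_x n_x(t)² ≤ T²/min(ω₂,1)`
(`CoherentPositionPointwise.sum_posResp_sq_le`) and the bookkeeping bound `sum_siteEnergy_le`. [folklore] -/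
theorem sum_cohEnergyDensity_le :
    ∀ ω₂ lam β γ : ℝ, 0 < ω₂ → 0 < lam → 0 < β → 0 < γ → ∀ T : ℝ, 0 < T → ∀ (N : ℕ) (t : ℝ), 0 < t →
      ∑ x : Fin (N + 1), cohEnergyDensity ω₂ lam β γ T N x t ≤ T ^ 2 * (1 / 2 + (ω₂ / 2 + 2) / min ω₂ 1) := by
  intro ω₂ lam β γ hω hl hβ hγ T hT N t ht
  have hM := CoherentEnergyPointwise.sum_momResp_sq_le ω₂ lam β γ hω hl hβ hγ T hT N t ht
  have hP := CoherentPositionPointwise.sum_posResp_sq_le ω₂ lam β γ hω hl hβ hγ T hT N t ht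
  have h := sum_siteEnergy_le (fun x => momResp ω₂ lam β γ T N x t) (fun x => posResp ω₂ lam β γ T N x t)
    hω.le hM hP
  have hK : T ^ 2 * (1 / 2 + (ω₂ / 2 + 2) / min ω₂ 1) = T ^ 2 / 2 + (ω₂ / 2 + 2) * (T ^ 2 / min ω₂ 1) := by
    ring
  rw [hK]
  simpa only [cohEnergyDensity] using h

end Summit.AtomisticToContinuum.FouriersLaw.Theorems.CoherentDephasing.CoherentEnergyTotal

end
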